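import Summits.BirchSwinnertonDyer.BirchSwinnertonDyer.Theorems.ByReductionTypeAtTwoSupersingularConjATwoGoodSSDoor
import HarnessLib

/-!
# D-imc-85 — THE NARROW DOOR for Conjecture A at `2` (cell `bsd-f1-sign2`, LENS = Iwasawa main conjecture, `-imc` g33;
# crux `SupersingularRankZeroAtTwo` stmt-BirchSwinnertonDyer-19097, registry v2.12′ stub 3 `stub_fineMu : FineMuZeroOnHabitatAtTwo`)

WHAT.  The class-wide good-supersingular Eisenstein door of `t42` GEN 43
(`AddKatoTwo.fineMuZeroAt_two_goodSSModel_of_oddClassNumber`: (A)₂ for `[0,a₂,1,a₄,a₆]` from `hLim2` = Lim 2017 Thm. 3.5 at `2`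
BY NAME plus ONE parity bit `2 ∤ h(ℚ(β))`, `β = 4x(P)` a `2`-division root) instantiates the named fact at the CUBIC point field
`L = ℚ(β)`.  The fact's own `scope_caveats` rider (`FineSelmerClassGroupCriterion.lean` ll. 444–461) records that Lim's printed proof
(Iwasawa 1973, «let `k` be totally imaginary if `ℓ = 2`») covers `L` totally imaginary, and `r₁(L) = 1` with `L ∩ ℚ^cyc = ℚ`, but NOT
`r₁(L) ≥ 2`: for `Δ_E > 0` the `2`-division cubic is TOTALLY REAL (`r₁ = 3`) and «consumers SHOULD instead instantiate
`L := ℚ(e₁, i) ≤ ℚ(E[4])`».  CENSUS (this file's data, `-imc` g33): of t42's 30 row stamps, **4 have `Δ_E > 0`** — `37b1`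
(`d(ℚ(β)) = 148`), `141e1` (`564`), `189c1` (`756`), `189d1` (`756`) — all four KERNEL-stamped (`conjA_two_37b1` …, field certificates
`odd_classNumber_of_root_twoDivField_d148p/d564p/d756p`) «mod `hLim2` alone», i.e. modulo the named fact CONSUMED OUTSIDE its
page-verified scope; 26/30 have `Δ_E < 0` (inside scope).  Of t42's 73-row queue `N ≤ 600`, 11 more rows have `d > 0`
(`325d1 325e1` 1300 · `333d1` 148 · `381b1` 1524 · `405a1 405e1` 1620 · `423d1 423e1` 564 · `485a1` 1940 · `557b1` 2228 · `573b1` 2292).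

THE LENS CANDIDATE (typed below).  **K85 `SexticDoorConjAAtTwo`** (THEOREM-candidate, corollary of tree + print INSIDE the printed scope):
the same door through the totally imaginary sextic `L′ = ℚ(β, ι)`, `ι² = −1`: `L′ ≤ ℚ(E[4])` (Weil pairing: `μ₄ ⊂ ℚ(E[4])`), index
`[ℚ(E[4]) : L′] ∣ 16`, ONE prime above `2` in `L′` (`2 = 𝔮³` in `ℚ(β)` by the Eisenstein cubic of `π = 2x(P)`; `ℚ₂(β, ι)/ℚ₂(β)` is
ramified since `e(ℚ₂(ι)) = 2 ∤ 3`; so `2 = 𝔔⁶`), totally ramified in the cyclotomic `ℤ₂`-tower; Iwasawa 1956 (one totally ramified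
prime, `2 ∤ h(L′)` ⟹ `X_∞ = 0` ⟹ `μ₂(L′) = 0`); then `hLim2` at `L′` — all inside print.  **K85-N `NarrowParityLawAtTwo`** (SUPPORT,
textbook — Chevalley's ambiguous class number formula for the quadratic extension `L′/L`, ramified exactly at the `r₁(L)` real places and
at `𝔮`, plus Hasse's norm theorem and the product formula for `(u, −1)_v`): `2 ∤ h(ℚ(β, ι)) ⟺ 2 ∤ h(ℚ(β)) ∧ ℚ(β) has units of every
signature ⟺ 2 ∤ h⁺(ℚ(β))` — **the honest in-scope bit of every row is the NARROW class number of the `2`-division cubic**; for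
`Δ_E < 0` (`r₁ = 1`, `−1` supplies the signature) it is the old bit `2 ∤ h(ℚ(β))` (so 26/30 stamps are in scope as they stand).
BC5-TYPE WITNESS (local exact arithmetic, `d85/unit_signatures.py`, pure python, seconds; HOME `MEMO-imc-data/g33/d85/`): the three
real cubic fields of the four `Δ_E > 0` stamps have UNITS OF ALL 8 SIGNATURES in `ℤ[θ]` already (`d = 148`: e.g. `1 − 3θ + θ²`
(`++−`), `−8 + 2θ + 5θ²` (`+−+`), `−4 + 11θ + 6θ²` (`−++`); `d = 564`: `2 − 4θ + θ²`, `−10 − θ + 2θ²`, `−4 + 7θ`; `d = 756`: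
`−1 − 5θ − 2θ²`, `−5 + θ²`, `1 + 3θ + θ²`; norms `±1` exact), so with t42's `h = 1` (`bnfcertify`) **`h⁺ = 1` and `2 ∤ h(ℚ(β, ι))` for
4/4**: the four rows CAN be re-keyed inside scope.  CHEAPEST FALSIFIER (run): a `Δ_E > 0` stamped row whose cubic lacks a unit of some
signature — 0/4.  DATA ASK D-imc-85 (→ `-data`/t42, kit tag `bsd-frontier-data`, one batched pari job): `bnfnarrow` for the `2`-division
cubic of every `Δ_E > 0` good-supersingular-at-2 class of SF2-ALL (and the 11 queued rows first): the census of «`h` odd but `h⁺` even»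
measures how much of the `Δ_E > 0` half of the habitat the narrow door certifies.  WHY NOVEL (searches RUN, labelled): Conjecture-A-from-
class-group arguments in print fix `p` odd — [corpus:paper:arxiv-2112.13335 p0005 L30] (Ray–Sujatha 2021: «`p` an odd prime … `F = ℚ(E[p])`,
`μ_p(F_cyc/F) = 0 ⟹ μ(fine) = 0`»), [corpus:paper:arxiv-2110.07386] (Kleine–Müller 2022, fine Selmer vs class groups: grep
`narrow|signature|totally real` → 0 lines); `lit search --hybrid "narrow class" "fine Selmer"` → no page joining them (hits: Buell, Bump,
Lemmermeyer quadratic fields); galaxy `"narrow class number|units of all signatures|totally positive units" --star all` → 24 generic rows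
(unit-signature literature, e.g. [galaxy:pdf:6876058703597731340] Davis 1969 on signs of cyclotomic units = the rider's `ℚ_n` input),
none with fine Selmer / Conjecture A; the real-place proviso itself is Iwasawa 1973 Thm. 2/3 (rider's cite).  Delta in one sentence: the
`p = 2` real-place defect of the class-group road to Conjecture A is repaired at FINITE level by one classical bit — the narrow class
number of the cubic — not by a new `μ`-computation.  Grade claimed: corollary-of-print (K85) + textbook (K85-N); value = honesty of the
`Δ_E > 0` half of stub 3's row ledger (director (815) lesson of record: run the scope pass before any «mod print X» label).

HONESTY.  Nothing here is proved beyond the two trivial glue theorems; K85/K85-N are `def … : Prop` candidates for a prover (t42 / `-ty`);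
no registry write; no row is re-stamped here; (A) at `2` remains Conjecture A class-wide, certified per row only; BSD is proved for no curve.
PARTITION 52421 = 17880 + 27650 + 3440 + 3451 (tree 60cbd0490886c010) unchanged; beyond-print theorem: no.

References: [Lim2017FineSelmer] Thm. 3.5, Lemma 3.2; [Iwasawa1973MuInvariants] Thm. 2, Thm. 3, §4; [Greenberg2001IwasawaPastPresent]
Prop. 2.1 (Iwasawa 1956); [Washington1997] §13.3, Thm. 13.22; Chevalley 1933 (ambiguous class number formula) as in [Gras2003ClassFieldTheory]
II.6 / Lemmermeyer, «The ambiguous class number formula revisited», J. Ramanujan Math. Soc. 28 (2013) 415–421 (arXiv:1309.3827);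
[SilvermanAEC2009] III.8 (Weil pairing, `μ_N ⊂ K(E[N])`); [Narkiewicz1990] Notes to Ch. 3 item 11; cell files named above.
-/

set_option autoImplicit false
-- sibling precedent (`D82…`, `D84…`): the directory name repeats the summit name
set_option linter.dupNamespace false

noncomputable section

open scoped Classical IntermediateField NumberField
open Polynomial NumberField Literature.NumberTheory.EllipticCurves

namespace Summit.BirchSwinnertonDyer.BirchSwinnertonDyer.Cruxes.SupersingularRankZeroAtTwo.D85

/-- «`K` has units of every signature»: for every set `S` of infinite places there is a unit of `𝓞 K` that is negative exactly at the
real places in `S` (complex places impose nothing).  Equivalent, for a number field, to `[E_K : E_K⁺] = 2^{r₁}`, i.e. `h⁺(K) = h(K)`.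
[cite: Narkiewicz1990, Ch. 3 §3 (signatures of units, narrow class number `h⁺ = h · 2^{r₁} / [E : E⁺]`)] -/
def UnitsOfAllSignatures (K : Type*) [Field K] : Prop :=
  ∀ S : Set (InfinitePlace K), ∃ u : (𝓞 K)ˣ, ∀ (w : InfinitePlace K) (hw : w.IsReal),
    (NumberField.InfinitePlace.embedding_of_isReal hw (algebraMap (𝓞 K) K u) < 0 ↔ w ∈ S)

/-- **K85-N `NarrowParityLawAtTwo`** (SUPPORT, textbook: Chevalley's ambiguous class number formula + Hasse norm theorem + product formula,
for the quadratic extension `ℚ(β, ι)/ℚ(β)` ramified exactly at the real places of `ℚ(β)` and at the unique prime `𝔮 ∣ 2`): on the good-ss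
minimal shape, `2 ∤ h(ℚ(β, ι))` iff `2 ∤ h(ℚ(β))` and `ℚ(β)` has units of every signature (iff `2 ∤ h⁺(ℚ(β))`).  Why it might fail as
typed: only through a junk reading (`Nat.card = 0` for an infinite class group cannot occur: both fields are number fields); the
`IsElliptic` guard makes the cubic separable, `64a₆ + 16 ≡ 16 (mod 64)` makes `π = β/2` Eisenstein at `2`.
[cite: Gras2003ClassFieldTheory, II.6.2 (Chevalley's formula)] [cite: Narkiewicz1990, Ch. 3 §3] -/
def NarrowParityLawAtTwo : Prop :=
  ∀ (a₂ a₄ a₆ : ℤ) [((⟨0, a₂, 1, a₄, a₆⟩ : WeierstrassCurve ℤ).baseChange ℚ).IsElliptic]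
    (β ι : AlgebraicClosure ℚ),
    aeval β (Cubic.toPoly ⟨1, ((4 * a₂ : ℤ) : ℚ), ((16 * a₄ : ℤ) : ℚ), ((64 * a₆ + 16 : ℤ) : ℚ)⟩) = 0 → ι ^ 2 = -1 →
    (¬ 2 ∣ Nat.card (ClassGroup (𝓞 ℚ⟮β, ι⟯)) ↔
      (¬ 2 ∣ Nat.card (ClassGroup (𝓞 ℚ⟮β⟯)) ∧ UnitsOfAllSignatures ℚ⟮β⟯))

/-- **K85 `SexticDoorConjAAtTwo`** (THEOREM-candidate, corollary of tree + print INSIDE Lim's printed scope): (A)₂ in the cell currency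
`Rank1Residual.FineMuZeroAt · 2` for the good-ss minimal shape `[0,a₂,1,a₄,a₆]` from `hLim2` instantiated at the totally imaginary sextic
`ℚ(β, ι) ≤ ℚ(E[4])` (index `∣ 16`; one prime above `2`, totally ramified in the cyclotomic `ℤ₂`-tower; Iwasawa 1956) and the parity bit
`2 ∤ h(ℚ(β, ι))`.  Why it might fail: only if `ℚ(β, ι) ≤ W.divisionField 4` or the `2`-power index fails to be derivable with the tree's
`divisionField` API (the mathematics — `μ₄ ⊂ ℚ(E[4])` by the Weil pairing — is textbook).
[cite: Lim2017FineSelmer, §3 Thm. 3.5 and Lemma 3.2] [cite: Greenberg2001IwasawaPastPresent, Prop. 2.1 p. 339] [cite: SilvermanAEC2009, III.8.1.1] -/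
def SexticDoorConjAAtTwo : Prop :=
  Lim2017.thm35_at_two_fineSelmerDual_moduleFinite_of_classicalMuVanishes_of_le_divisionField_four →
  ∀ (a₂ a₄ a₆ : ℤ) [((⟨0, a₂, 1, a₄, a₆⟩ : WeierstrassCurve ℤ).baseChange ℚ).IsElliptic]
    (β ι : AlgebraicClosure ℚ),
    aeval β (Cubic.toPoly ⟨1, ((4 * a₂ : ℤ) : ℚ), ((16 * a₄ : ℤ) : ℚ), ((64 * a₆ + 16 : ℤ) : ℚ)⟩) = 0 → ι ^ 2 = -1 →
    ¬ 2 ∣ Nat.card (ClassGroup (𝓞 ℚ⟮β, ι⟯)) →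
    Rank1Residual.FineMuZeroAt (((⟨0, a₂, 1, a₄, a₆⟩ : WeierstrassCurve ℤ).baseChange ℚ)) 2

/-- **THE NARROW DOOR** (kernel glue, sorry-free): K85 ∧ K85-N ⟹ (A)₂ on the good-ss minimal shape from `hLim2`, the OLD bit
`2 ∤ h(ℚ(β))` and «units of every signature in `ℚ(β)`» — i.e. from `2 ∤ h⁺(ℚ(β))`; inside Lim's printed scope for BOTH signs of `Δ_E`. -/
theorem fineMuZeroAt_two_goodSSModel_of_oddNarrowClassNumber (hK : SexticDoorConjAAtTwo) (hN : NarrowParityLawAtTwo)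
    (hLim2 : Lim2017.thm35_at_two_fineSelmerDual_moduleFinite_of_classicalMuVanishes_of_le_divisionField_four)
    (a₂ a₄ a₆ : ℤ) [((⟨0, a₂, 1, a₄, a₆⟩ : WeierstrassCurve ℤ).baseChange ℚ).IsElliptic]
    {β : AlgebraicClosure ℚ}
    (hβ : aeval β (Cubic.toPoly ⟨1, ((4 * a₂ : ℤ) : ℚ), ((16 * a₄ : ℤ) : ℚ), ((64 * a₆ + 16 : ℤ) : ℚ)⟩) = 0)
    (hh : ¬ 2 ∣ Nat.card (ClassGroup (𝓞 ℚ⟮β⟯))) (hsig : UnitsOfAllSignatures ℚ⟮β⟯) :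
    Rank1Residual.FineMuZeroAt (((⟨0, a₂, 1, a₄, a₆⟩ : WeierstrassCurve ℤ).baseChange ℚ)) 2 := by
  obtain ⟨ι, hι⟩ := IsAlgClosed.exists_pow_nat_eq (-1 : AlgebraicClosure ℚ) (by norm_num : 0 < 2)
  exact hK hLim2 a₂ a₄ a₆ β ι hβ hι ((hN a₂ a₄ a₆ β ι hβ hι).mpr ⟨hh, hsig⟩)

/-- The converse bookkeeping: under K85-N, a row whose sextic bit holds already has the cubic bit (so every in-scope row is also a
t42 row). -/
theorem oddClassNumber_cubic_of_sextic (hN : NarrowParityLawAtTwo)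
    (a₂ a₄ a₆ : ℤ) [((⟨0, a₂, 1, a₄, a₆⟩ : WeierstrassCurve ℤ).baseChange ℚ).IsElliptic]
    {β ι : AlgebraicClosure ℚ}
    (hβ : aeval β (Cubic.toPoly ⟨1, ((4 * a₂ : ℤ) : ℚ), ((16 * a₄ : ℤ) : ℚ), ((64 * a₆ + 16 : ℤ) : ℚ)⟩) = 0) (hι : ι ^ 2 = -1)
    (h : ¬ 2 ∣ Nat.card (ClassGroup (𝓞 ℚ⟮β, ι⟯))) :
    ¬ 2 ∣ Nat.card (ClassGroup (𝓞 ℚ⟮β⟯)) :=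
  ((hN a₂ a₄ a₆ β ι hβ hι).mp h).1

end Summit.BirchSwinnertonDyer.BirchSwinnertonDyer.Cruxes.SupersingularRankZeroAtTwo.D85

end
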